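import Summits.BirchSwinnertonDyer.BirchSwinnertonDyer.Theorems.AdditiveKolyvaginRoadBottomTransferKrizLiAtOne
import Literature.NumberTheory.EllipticCurves.LocalTorsionGoodReductionProofs
import Literature.NumberTheory.EllipticCurves.AnomalousOfRationalTorsionProofs
import Literature.NumberTheory.EllipticCurves.LFunctionPrimeCoeff
import HarnessLib

/-!
# Route `AdditiveKolyvaginRoad`, crux KS′ `LevelKolyvaginSystemsAdditive` (item stmt-BirchSwinnertonDyer-21396):
# the LENDER side of the conductor-one Kriz–Li transfer — the log-unit hypothesis of
# `kolyvaginClass_one_ne_zero_of_thm116` IS «the avatar's Heegner point is not `p`-divisible in `E₀(ℚ_p)`»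
# (cell `pub/bsd-wall`, width seat `bsd-wall-akr-p2x-w3` g4; `--supports stmt-BirchSwinnertonDyer-21396`, helper; part 2 of 2)

WHY. Part 1 (`…BottomTransferKrizLiAtOne`) proved the E-side of sub-row (γ) of stub (A2) `stub_bottomTransfer` (line
`epsilon_matched_retyping`): Kriz–Li Thm. 1.16 + the frame ⟹ `c_E(1) ≠ 0`, CONDITIONAL on the LENDER LOG-UNIT
«`ord_p(∏|Ẽ₀^{ns}|/ℓ) + ord_p log_{ω₀} y₀ − ord_p c₀ = 0`» for the avatar's Heegner point `y₀ ∈ E₀(K)`. THIS FILE computes that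
hypothesis on the avatar side (`E₀` GOOD and NON-ANOMALOUS at `p`, the locus binder `hna`): there `log_{ω₀}(E₀(ℚ_p)) = pℤ_p` exactly and
`|Ẽ₀(𝔽_p)|/p` has `ord_p = −1`, so the log-unit says `ord_p log_{ω₀} y₀ = 1`, i.e. **`y₀ ∉ p·E₀(ℚ_p)`** (the card's «H_log»); and it
removes Gross–Zagier from part 1 (a torsion `y_K` would contradict the congruence).
* §1 `padicValNat_card_torsion_eq_zero_of_forall` (Cauchy); `range_padicLog_baseChange_of_good_of_not_anomalous` (`log_ω(E(ℚ_p)) = pℤ_p`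
  at a good non-anomalous `p ≥ 3`: the tree's `range_padicLog_baseChange_of_good` with `E(ℚ_p)[p] = 0` and `p ∤ #Ẽ(𝔽_p)`);
  `not_isOfFinAddOrder_and_padicLogOrd_eq_one_of_not_exists_zsmul_eq` (a point whose image is NOT `p`-divisible in `E(ℚ_p)` has
  infinite order and `ord_p log_ω = 1`: torsion of `E(ℚ_p)` is prime to `p`, hence `p`-divisible; `ord_p ≥ 2` would make `P_ι − pQ` torsion).
* §2 `eulerFactorOrd_eq_neg_one_of_good` (the lender-side exponent is `−1` given `hna` and the off-`p` unit condition `hdep`, vacuous when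
  the depletion set is `{p}`); `lenderLogUnit_of_not_exists_zsmul_eq` — **part 1's log-unit hypothesis DISCHARGED from «`y₀ ∉ p·E₀(ℚ_p)`»**.
* §3 `not_isOfFinAddOrder_of_thm116` (infinite order of `y_K` from the congruence + lender unit alone);
  `kolyvaginClass_one_ne_zero_of_thm116'` — part 1's transfer with the Gross–Zagier ∕ modularity ∕ analytic-rank ∕ twist inputs REMOVED.
* §4 `kolyvaginClass_one_ne_zero_of_thm116_of_lossless`, `exists_kolyvaginClass_ne_zero_of_thm116_of_lossless` — parts 1 + 2 in one
  statement (the second in the conclusion shape of `stub_bottomTransfer`, `m = ∅`).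

HONEST FRAMING: theorems only; 0 definitions, 0 named facts, 0 `sorry`; CONDITIONAL on `hKL` (named fact, by name) and on the lossless-
localisation hypothesis for the LENDER (K-half; Zhang 2014 gives only `y₀ ∉ pE₀(K)` on the rank-one locus — `y₀ ∉ pE₀(K_𝔭)` is NOT
claimed here). Closes nothing; KS′ is not proved; BSD is NOT proved by any of this.

References: [cite: KrizLi2019, Thm. 1.16, Rem. 1.17] [cite: SilvermanAEC2009, IV.6.4, VII.2.1, VII.3.1, VII.6.3]
[cite: Kim2022StructureSelmer, §3.1.1, Lemma 3.10] [cite: WZhang2014, Thm. 7.2, Thm. 9.3] [cite: GrossLMS1991, §4 (4.4)].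
-/

set_option linter.dupNamespace false -- single-conjunct summit repeats the name by design

noncomputable section

open scoped Classical

namespace Summit.BirchSwinnertonDyer.BirchSwinnertonDyer.Theorems.AdditiveKoly

open WeierstrassCurve NumberField IsDedekindDomain Field
  Literature.NumberTheory.EllipticCurves Literature.NumberTheory.EllipticCurves.ModularForms
  Literature.NumberTheory.EllipticCurves.Rank1Residual Literature.NumberTheory.GaloisRepresentations
  Summit.BirchSwinnertonDyer.Rank1Residual Summit.BirchSwinnertonDyer.Rank1Residual.Additive
  Summit.BirchSwinnertonDyer.Rank1Residual.O5

/-! ## §1 `log_ω(E(ℚ_p)) = pℤ_p` at a good non-anomalous prime, and the local divisibility test -/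

section Cauchy

variable {p : ℕ} [hp : Fact p.Prime]

/-- **No point of order `p` ⟹ `p ∤ #E(ℚ_p)_tors`** (Cauchy). [cite: SilvermanAEC2009, VII.3 Prop. 3.1] -/
theorem padicValNat_card_torsion_eq_zero_of_forall (X : WeierstrassCurve ℚ_[p]) [X.IsIntegral ℤ_[p]] [X.IsElliptic]
    (ht : ∀ P : X.toAffine.Point, p • P = 0 → P = 0) :
    padicValNat p (Nat.card (AddCommGroup.torsion X.toAffine.Point)) = 0 := by
  apply padicValNat.eq_zero_of_not_dvd
  intro hdvd
  haveI := LocalLog.finite_torsion_point X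
  obtain ⟨T, hT⟩ := exists_prime_addOrderOf_dvd_card' (G := AddCommGroup.torsion X.toAffine.Point) p hdvd
  have hpT' : p • T = 0 := by
    have h := addOrderOf_nsmul_eq_zero T
    rwa [hT] at h
  have hpT : p • (T : X.toAffine.Point) = 0 := by
    have h := congrArg Subtype.val hpT'
    simpa only [AddSubgroupClass.coe_nsmul, ZeroMemClass.coe_zero] using h
  have hT0 : T = 0 := Subtype.ext (ht _ hpT)
  rw [hT0, addOrderOf_zero] at hT
  exact hp.out.one_lt.ne hT

end Cauchy

section Local

variable (W : WeierstrassCurve ℚ) [W.IsElliptic] [W.IsGloballyMinimal] (p : ℕ) [hp : Fact p.Prime]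
  {K : Type} [Field K] [NumberField K]

/-- **`log_ω(E(ℚ_p)) = pℤ_p` at a GOOD NON-ANOMALOUS `p ≥ 3`** (`range_padicLog_baseChange_of_good` with `t = 0` and `p ∤ #Ẽ(𝔽_p)`).
[cite: Kim2022StructureSelmer, §3.1.1 and §3.2.3] [cite: SilvermanAEC2009, IV.6.4, VII.6.3] -/
theorem range_padicLog_baseChange_of_good_of_not_anomalous (hp3 : 3 ≤ p) (hgood : W.HasGoodReductionAtPrime p)
    (hna : ¬ (p : ℤ) ∣ W.frobeniusTrace p - 1) :
    (LocalLog.padicLog (W.baseChange ℚ_[p])).range = (Submodule.span ℤ_[p] {(p : ℚ_[p])}).toAddSubgroup := by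
  rw [LocalLog.range_padicLog_baseChange_of_good W p hgood,
    padicValNat_card_torsion_eq_zero_of_forall (W.baseChange ℚ_[p])
      (localTorsion_eq_zero_of_good_of_not_dvd_frobeniusTrace_sub_one W p hp3 hgood hna),
    padicValNat.eq_zero_of_not_dvd
      (fun h ↦ hna ((dvd_reductionPointCount_iff_dvd_frobeniusTrace_sub_one W p).mp h)),
    Nat.cast_zero, add_zero, sub_zero, zpow_one]

/-- **Local divisibility test at a good non-anomalous prime**: if `P_ι ∈ E(ℚ_p)` is NOT `p·Q`, then `P` has infinite order and
`ord_p log_ω P = 1` (torsion of `E(ℚ_p)` is prime to `p` hence `p`-divisible; `log_ω(E(ℚ_p)) = pℤ_p`; `ord_p ≥ 2` would make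
`P_ι − pQ` torsion). [cite: SilvermanAEC2009, IV.6.4, VII.3.1, VII.6.3] [cite: Castella2018, §2.2] -/
theorem not_isOfFinAddOrder_and_padicLogOrd_eq_one_of_not_exists_zsmul_eq (hp3 : 3 ≤ p)
    (hgood : W.HasGoodReductionAtPrime p) (hna : ¬ (p : ℤ) ∣ W.frobeniusTrace p - 1) (ι : K →+* ℚ_[p])
    {P : (W.baseChange K).toAffine.Point}
    (hP : ¬ ∃ Q : (W.baseChange ℚ_[p]).toAffine.Point, (p : ℤ) • Q = X11b.padicPointOf W p ι P) :
    ¬ IsOfFinAddOrder P ∧ padicLogOrd W p ι P = 1 := by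
  have htors : ∀ T : (W.baseChange ℚ_[p]).toAffine.Point, p • T = 0 → T = 0 :=
    localTorsion_eq_zero_of_good_of_not_dvd_frobeniusTrace_sub_one W p hp3 hgood hna
  have hdiv : ∀ T : (W.baseChange ℚ_[p]).toAffine.Point, IsOfFinAddOrder T →
      ∃ Q : (W.baseChange ℚ_[p]).toAffine.Point, (p : ℤ) • Q = T := by
    intro T hT
    have hn0 : addOrderOf T ≠ 0 := hT.addOrderOf_pos.ne'
    have hcop : Nat.Coprime p (addOrderOf T) := by
      rw [Nat.Prime.coprime_iff_not_dvd hp.out]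
      rintro ⟨m, hm⟩
      have hm0 : m ≠ 0 := by
        rintro rfl
        exact hn0 (by rw [hm, mul_zero])
      have hmlt : m < addOrderOf T := by
        rw [hm]
        exact lt_mul_left (Nat.pos_of_ne_zero hm0) hp.out.one_lt
      have hmT : p • (m • T) = 0 := by
        rw [smul_smul, ← hm]
        exact addOrderOf_nsmul_eq_zero T
      exact nsmul_ne_zero_of_lt_addOrderOf hm0 hmlt (htors _ hmT)
    obtain ⟨a, b, hab⟩ := Nat.isCoprime_iff_coprime.mpr hcop
    refine ⟨a • T, ?_⟩
    have hnT : ((addOrderOf T : ℕ) : ℤ) • T = 0 := by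
      rw [natCast_zsmul]
      exact addOrderOf_nsmul_eq_zero T
    calc (p : ℤ) • a • T = (a * p) • T + b • (((addOrderOf T : ℕ) : ℤ) • T) := by
          rw [hnT, zsmul_zero, add_zero, smul_smul, mul_comm]
      _ = (a * p + b * (addOrderOf T : ℕ)) • T := by rw [add_zsmul, smul_smul]
      _ = T := by rw [hab, one_zsmul]
  have hPι : ¬ IsOfFinAddOrder (X11b.padicPointOf W p ι P) := fun h ↦ hP (hdiv _ h)
  have hPinf : ¬ IsOfFinAddOrder P := fun h ↦ hPι (by
    rw [X11b.padicPointOf]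
    exact (WeierstrassCurve.Affine.Point.map ι.toRatAlgHom).isOfFinAddOrder h)
  refine ⟨hPinf, ?_⟩
  have hL0 : LocalLog.padicLog (W.baseChange ℚ_[p]) (X11b.padicPointOf W p ι P) ≠ 0 :=
    fun h ↦ hPι ((LocalLog.padicLog_eq_zero_iff _ _).mp h)
  have hmem : LocalLog.padicLog (W.baseChange ℚ_[p]) (X11b.padicPointOf W p ι P) ∈
      (LocalLog.padicLog (W.baseChange ℚ_[p])).range := ⟨_, rfl⟩
  rw [range_padicLog_baseChange_of_good_of_not_anomalous W p hp3 hgood hna, Submodule.mem_toAddSubgroup,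
    Submodule.mem_span_singleton] at hmem
  obtain ⟨a, ha⟩ := hmem
  have ha0 : a ≠ 0 := by
    rintro rfl
    rw [zero_smul] at ha
    exact hL0 ha.symm
  have haunit : ‖a‖ = 1 := by
    by_contra hne
    have hlt : ‖a‖ < 1 := lt_of_le_of_ne a.norm_le_one hne
    obtain ⟨b, hb⟩ : (p : ℤ_[p]) ∣ a := (PadicInt.norm_lt_one_iff_dvd a).mp hlt
    have hbmem : b • (p : ℚ_[p]) ∈ (LocalLog.padicLog (W.baseChange ℚ_[p])).range := by
      rw [range_padicLog_baseChange_of_good_of_not_anomalous W p hp3 hgood hna, Submodule.mem_toAddSubgroup]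
      exact Submodule.smul_mem _ b (Submodule.mem_span_singleton_self _)
    obtain ⟨Q, hQ⟩ := hbmem
    have hPQ : LocalLog.padicLog (W.baseChange ℚ_[p]) (X11b.padicPointOf W p ι P - (p : ℤ) • Q) = 0 := by
      rw [map_sub, map_zsmul, hQ, ← ha, hb, zsmul_eq_mul]
      simp only [Algebra.smul_def, PadicInt.algebraMap_apply, PadicInt.coe_mul, PadicInt.coe_natCast, Int.cast_natCast]
      ring
    have htor : IsOfFinAddOrder (X11b.padicPointOf W p ι P - (p : ℤ) • Q) :=
      (LocalLog.padicLog_eq_zero_iff _ _).mp hPQ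
    obtain ⟨R, hR⟩ := hdiv _ htor
    exact hP ⟨R + Q, by rw [zsmul_add, hR, sub_add_cancel]⟩
  have hX : padicLogOrd W p ι P = X11b.padicLogOrd W p ι P := rfl
  have haq : (a : ℚ_[p]) ≠ 0 := PadicInt.coe_ne_zero.mpr ha0
  have hp0 : (p : ℚ_[p]) ≠ 0 := by exact_mod_cast hp.out.ne_zero
  have hva : (a : ℚ_[p]).valuation = 0 := by
    have h1 : (p : ℝ) ^ (-(a : ℚ_[p]).valuation) = (p : ℝ) ^ (0 : ℤ) := by
      rw [zpow_zero, ← Padic.norm_eq_zpow_neg_valuation haq, ← PadicInt.norm_def, haunit]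
    have hpos : (0 : ℝ) < p := by exact_mod_cast hp.out.pos
    have hne1 : (p : ℝ) ≠ 1 := by exact_mod_cast hp.out.ne_one
    have := zpow_right_injective₀ hpos hne1 h1
    omega
  rw [hX, LocalLog.padicLogOrd_eq_valuation_padicLog W p ι P hPι, ← ha, Algebra.smul_def,
    PadicInt.algebraMap_apply, Padic.valuation_mul haq hp0, hva, Padic.valuation_p]
  simp

end Local

/-! ## §2 The lender's log-unit from «`y₀ ∉ p·E₀(ℚ_p)`» -/

section Lender

variable (W₀ : WeierstrassCurve ℚ) [W₀.IsElliptic] [W₀.IsGloballyMinimal] (p : ℕ) [hp : Fact p.Prime]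

omit [W₀.IsGloballyMinimal] in
/-- `|Ẽ₀^{ns}(𝔽_p)| = p + 1 − a_p` at a GOOD prime is prime to `p` when `a_p ≢ 1 (mod p)`. [cite: KrizLi2019, Rem. 1.17] -/
theorem not_dvd_nsPointCount_of_good_of_not_anomalous [W₀.IsGloballyMinimal] (hgood : W₀.HasGoodReductionAtPrime p)
    (hna : ¬ (p : ℤ) ∣ W₀.frobeniusTrace p - 1) : ¬ (p : ℤ) ∣ KrizLi2019.nsPointCount W₀ p := by
  unfold KrizLi2019.nsPointCount
  rw [dif_pos hp.out, W₀.LFunction_apply_prime_eq_frobeniusTrace p hgood]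
  simp only [hgood, if_true]
  intro h
  apply hna
  have : W₀.frobeniusTrace p - 1 = (p : ℤ) - ((p : ℤ) + 1 - W₀.frobeniusTrace p) := by ring
  rw [this]
  exact dvd_sub (dvd_refl _) h

/-- **Kriz–Li's exponent on the LENDER side is `−1`** at a good non-anomalous `p`, given the off-`p` unit condition `hdep`
(vacuous when the depletion set is `{p}`). [cite: KrizLi2019, Thm. 1.16, Rem. 1.17] -/
theorem eulerFactorOrd_eq_neg_one_of_good (W : WeierstrassCurve ℚ) [NeZero (W₀.conductorNorm ℤ)] [NeZero (W.conductorNorm ℤ)]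
    (hgood : W₀.HasGoodReductionAtPrime p) (hna : ¬ (p : ℤ) ∣ W₀.frobeniusTrace p - 1)
    (hdep : ∀ ℓ ∈ KrizLi2019.depletionPrimes p W₀ W, ℓ ≠ p → ¬ (p : ℤ) ∣ KrizLi2019.nsPointCount W₀ ℓ) :
    KrizLi2019.eulerFactorOrd p W₀ W = -1 := by
  unfold KrizLi2019.eulerFactorOrd
  have h1 : padicValInt p (KrizLi2019.nsPointCount W₀ p) = 0 :=
    padicValInt.eq_zero_of_not_dvd (not_dvd_nsPointCount_of_good_of_not_anomalous W₀ p hgood hna)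
  have h2 : ∑ ℓ ∈ (KrizLi2019.depletionPrimes p W₀ W).erase p,
      ((padicValInt p (KrizLi2019.nsPointCount W₀ ℓ) : ℤ) - if ℓ = p then 1 else 0) = 0 := by
    refine Finset.sum_eq_zero fun ℓ hℓ ↦ ?_
    obtain ⟨hℓp, hℓmem⟩ := Finset.mem_erase.mp hℓ
    rw [if_neg hℓp, padicValInt.eq_zero_of_not_dvd (hdep ℓ hℓmem hℓp)]
    simp
  rw [← Finset.add_sum_erase _ _ (KrizLi2019.self_mem_depletionPrimes p W₀ W), h2]
  simp [h1]

variable {K : Type} [Field K] [NumberField K]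

/-- **The LENDER LOG-UNIT of part 1, DISCHARGED from lossless localisation**: for the avatar (GOOD, NON-ANOMALOUS at `p ≥ 3`,
`p ∤ c(Dt₀)`, `hdep`) and `P₀ ∈ E₀(K)` over `heegnerPointComplex Dt₀ H₀` NOT `p`-divisible in `E₀(ℚ_p)` along `ιp`, the `∃`-hypothesis
`hunit₀` of `kolyvaginClass_one_ne_zero_of_thm116` holds (`−1 + 1 − 0 = 0`). [cite: KrizLi2019, Thm. 1.16, Rem. 1.17] -/
theorem lenderLogUnit_of_not_exists_zsmul_eq (W : WeierstrassCurve ℚ) [NeZero (W₀.conductorNorm ℤ)]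
    [NeZero (W.conductorNorm ℤ)] (hp3 : 3 ≤ p)
    (hgood : W₀.HasGoodReductionAtPrime p) (hna : ¬ (p : ℤ) ∣ W₀.frobeniusTrace p - 1)
    (hdep : ∀ ℓ ∈ KrizLi2019.depletionPrimes p W₀ W, ℓ ≠ p → ¬ (p : ℤ) ∣ KrizLi2019.nsPointCount W₀ ℓ)
    (Dt₀ : ModularParametrizationData W₀ (W₀.conductorNorm ℤ)) (hc₀ : ¬ (p : ℤ) ∣ Dt₀.c) (ι : K →+* ℂ) (ιp : K →+* ℚ_[p])
    (H₀ : HeegnerDatum (W₀.conductorNorm ℤ) (NumberField.discr K)) (P₀ : (W₀.baseChange K).toAffine.Point)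
    (hP₀ : WeierstrassCurve.Affine.Point.map ι.toRatAlgHom P₀ = heegnerPointComplex Dt₀ H₀)
    (hloss : ¬ ∃ Q : (W₀.baseChange ℚ_[p]).toAffine.Point, (p : ℤ) • Q = X11b.padicPointOf W₀ p ιp P₀) :
    ∃ (H₀ : HeegnerDatum (W₀.conductorNorm ℤ) (NumberField.discr K)) (P₀ : (W₀.baseChange K).toAffine.Point),
      WeierstrassCurve.Affine.Point.map ι.toRatAlgHom P₀ = heegnerPointComplex Dt₀ H₀ ∧ ¬ IsOfFinAddOrder P₀ ∧
        KrizLi2019.eulerFactorOrd p W₀ W + padicLogOrd W₀ p ιp P₀ - padicValInt p Dt₀.c = 0 := by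
  obtain ⟨hinf, hord⟩ :=
    not_isOfFinAddOrder_and_padicLogOrd_eq_one_of_not_exists_zsmul_eq W₀ p hp3 hgood hna ιp hloss
  refine ⟨H₀, P₀, hP₀, hinf, ?_⟩
  rw [eulerFactorOrd_eq_neg_one_of_good W₀ p W hgood hna hdep, hord, padicValInt.eq_zero_of_not_dvd hc₀]
  simp

end Lender

/-! ## §3 Infinite order of `y_K` from the congruence itself (no Gross–Zagier), and the GZ-free transfer -/

section NoGZ

variable (W : WeierstrassCurve ℚ) [W.IsElliptic] [W.IsGloballyMinimal] [NeZero (W.conductorNorm ℤ)]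
  (p : ℕ) [hp : Fact p.Prime] {K : Type} [Field K] [NumberField K]

/-- **`y_K` has infinite order from the congruence and the lender's unit alone**: a torsion `P` has `log_ω P = 0`, and Thm. 1.16
would give `‖ε·(∏|Ẽ₀^{ns}|/ℓ)·log_{ω₀} P₀/c₀‖ ≤ p⁻¹`, contradicting that this element has valuation `0`. No Gross–Zagier.
[cite: KrizLi2019, Thm. 1.16] [cite: KrausOesterle1992, §3 Prop. 3 (i) ⇒ (iii)] -/
theorem not_isOfFinAddOrder_of_thm116 (hKL : KrizLi2019.thm116_padicLogHeegner_congruence)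
    (W₀ : WeierstrassCurve ℚ) [W₀.IsElliptic] [W₀.IsGloballyMinimal] [NeZero (W₀.conductorNorm ℤ)]
    (e : geomTorsion W (p : ℤ) ≃+ geomTorsion W₀ (p : ℤ))
    (he : ∀ (σ : absoluteGaloisGroup ℚ) (T : geomTorsion W (p : ℤ)), e (σ • T) = σ • e T)
    (Dt : ModularParametrizationData W (W.conductorNorm ℤ)) (Dt₀ : ModularParametrizationData W₀ (W₀.conductorNorm ℤ))
    (hK : IsImaginaryQuadratic K) (hH : SatisfiesHeegnerHypothesis (W.conductorNorm ℤ) K)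
    (hH₀ : SatisfiesHeegnerHypothesis (W₀.conductorNorm ℤ) K)
    (hsplit : ((Ideal.span {(p : ℤ)}).primesOver (𝓞 K)).ncard = 2)
    (H : HeegnerDatum (W.conductorNorm ℤ) (NumberField.discr K))
    (H₀ : HeegnerDatum (W₀.conductorNorm ℤ) (NumberField.discr K)) (ι : K →+* ℂ) (ιp : K →+* ℚ_[p])
    (P : (W.baseChange K).toAffine.Point) (P₀ : (W₀.baseChange K).toAffine.Point)
    (hP : WeierstrassCurve.Affine.Point.map ι.toRatAlgHom P = heegnerPointComplex Dt H)
    (hP₀ : WeierstrassCurve.Affine.Point.map ι.toRatAlgHom P₀ = heegnerPointComplex Dt₀ H₀)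
    (hP₀inf : ¬ IsOfFinAddOrder P₀) (hc₀ : Dt₀.c ≠ 0)
    (hunit₀ : KrizLi2019.eulerFactorOrd p W₀ W + padicLogOrd W₀ p ιp P₀ - padicValInt p Dt₀.c = 0) :
    ¬ IsOfFinAddOrder P := by
  intro hfin
  have hcong : ∀ ℓ : ℕ, ℓ.Prime → ¬ (ℓ ∣ p * W.conductorNorm ℤ * W₀.conductorNorm ℤ) →
      ((W.LFunction ℓ : ℤ) : ZMod p) = ((W₀.LFunction ℓ : ℤ) : ZMod p) :=
    fun ℓ hℓ hnd ↦ KrausOesterle1992.lFunction_congr_of_addEquiv_geomTorsion W W₀ p e he hℓ hnd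
  have hX0 : Castella2018.padicLogOmega W p ιp P = 0 := by
    rw [HeegnerLogTransport.padicLogOmega_eq_padicLog, LocalLog.padicLog_eq_zero_iff, X11b.padicPointOf]
    exact (WeierstrassCurve.Affine.Point.map ιp.toRatAlgHom).isOfFinAddOrder hfin
  obtain ⟨ε, hε, hle⟩ := hKL p W W₀ hcong Dt Dt₀ K hK hH hH₀ hsplit H H₀ ι ιp P P₀ hP hP₀
  set X' : ℚ_[p] := ((KrizLi2019.eulerFactor p W₀ W : ℚ) : ℚ_[p]) *
    (Castella2018.padicLogOmega W₀ p ιp P₀ / (Dt₀.maninConstant : ℚ_[p])) with hX'def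
  rw [hX0, zero_div, mul_zero, zero_sub, norm_neg, norm_mul] at hle
  have hεn : ‖(ε : ℚ_[p])‖ = 1 := by
    rcases hε with rfl | rfl <;> simp
  rw [hεn, one_mul] at hle
  have hE0 : ((KrizLi2019.eulerFactor p W₀ W : ℚ) : ℚ_[p]) ≠ 0 := by
    exact_mod_cast HeegnerLogTransport.eulerFactor_ne_zero p W₀ W
  have hL0 : Castella2018.padicLogOmega W₀ p ιp P₀ ≠ 0 := HeegnerLogTransport.padicLogOmega_ne_zero W₀ p ιp hP₀inf
  have hc0' : (Dt₀.maninConstant : ℚ_[p]) ≠ 0 := by exact_mod_cast hc₀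
  have hX'0 : X' ≠ 0 := mul_ne_zero hE0 (div_ne_zero hL0 hc0')
  have hv : X'.valuation = 0 := by
    rw [hX'def, Padic.valuation_mul hE0 (div_ne_zero hL0 hc0'), KrizLi2019.valuation_eulerFactor p W₀ W
      (HeegnerLogTransport.eulerFactor_ne_zero p W₀ W), div_eq_mul_inv, Padic.valuation_mul hL0 (inv_ne_zero hc0'),
      Castella2018.valuation_padicLogOmega hL0, Padic.valuation_inv, Padic.valuation_intCast, ← hunit₀,
      show Dt₀.maninConstant = Dt₀.c from rfl]
    ring
  have hnorm : ‖X'‖ = 1 := by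
    rw [Padic.norm_eq_zpow_neg_valuation hX'0, hv, neg_zero, zpow_zero]
  rw [hnorm] at hle
  have hp1 : (1 : ℝ) < p := by exact_mod_cast hp.out.one_lt
  exact not_lt.mpr hle (inv_lt_one_of_one_lt₀ hp1)

variable (K) in
/-- **THE (γ) TRANSFER AT CONDUCTOR ONE, GROSS–ZAGIER-FREE**: part 1's `kolyvaginClass_one_ne_zero_of_thm116` with the inputs
`gross_zagier`, `hasEntireLFunction_rat`, `analyticRank = 1`, `L(E^{(d_K)},1) ≠ 0` REMOVED (infinite order of `y_K` by
`not_isOfFinAddOrder_of_thm116`). `hKL` BY NAME; LENDER LOG-UNIT along `ιp` as hypothesis. [cite: KrizLi2019, Thm. 1.16, Rem. 1.17]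
[cite: GrossLMS1991, §4 (4.4)] [cite: McCallumLMS1991, Cor. 4.5] -/
theorem kolyvaginClass_one_ne_zero_of_thm116' (Dt : ModularParametrizationData W (W.conductorNorm ℤ)) (β : ℤ)
    (ι : K →+* ℂ) (hKL : KrizLi2019.thm116_padicLogHeegner_congruence)
    (hp5 : 5 ≤ p) (hadd : Addv W p) (hs : W.HasSurjectiveModNGaloisRep p)
    (hK : IsImaginaryQuadratic K) (hlt : NumberField.discr K < -4)
    (hH : SatisfiesHeegnerHypothesis (W.conductorNorm ℤ) K) (hc : ¬ (p : ℤ) ∣ Dt.c)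
    (W₀ : WeierstrassCurve ℚ) [W₀.IsElliptic] [W₀.IsGloballyMinimal] [NeZero (W₀.conductorNorm ℤ)]
    (e : geomTorsion W (p : ℤ) ≃+ geomTorsion W₀ (p : ℤ))
    (he : ∀ (σ : absoluteGaloisGroup ℚ) (T : geomTorsion W (p : ℤ)), e (σ • T) = σ • e T)
    (Dt₀ : ModularParametrizationData W₀ (W₀.conductorNorm ℤ)) (hc₀ : Dt₀.c ≠ 0)
    (hH₀ : SatisfiesHeegnerHypothesis (W₀.conductorNorm ℤ) K)
    (hsplit : ((Ideal.span {(p : ℤ)}).primesOver (𝓞 K)).ncard = 2) (ιp : K →+* ℚ_[p])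
    (hunit₀ : ∃ (H₀ : HeegnerDatum (W₀.conductorNorm ℤ) (NumberField.discr K)) (P₀ : (W₀.baseChange K).toAffine.Point),
      WeierstrassCurve.Affine.Point.map ι.toRatAlgHom P₀ = heegnerPointComplex Dt₀ H₀ ∧ ¬ IsOfFinAddOrder P₀ ∧
        KrizLi2019.eulerFactorOrd p W₀ W + padicLogOrd W₀ p ιp P₀ - padicValInt p Dt₀.c = 0)
    (d : KolyvaginHeegnerData Dt β ι 1) :
    d.kolyvaginClass hp.out 1 ≠ 0 := by
  obtain ⟨y, H, hyd, hyH⟩ := exists_heegnerPoint_over_derivedPoint_one W K Dt β ι hK hH d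
  obtain ⟨H₀, P₀, hP₀, hP₀inf, hunit⟩ := hunit₀
  have hyinf : ¬ IsOfFinAddOrder y :=
    not_isOfFinAddOrder_of_thm116 W p hKL W₀ e he Dt Dt₀ hK hH hH₀ hsplit H H₀ ι ιp y P₀ hyH hP₀ hP₀inf hc₀ hunit
  have hle : padicLogOrd W p ιp y ≤ 0 :=
    padicLogOrd_le_zero_of_thm116 W p hKL W₀ hadd e he Dt Dt₀ hK hH hH₀ hsplit H H₀ ι ιp y P₀ hyH hP₀ hyinf hP₀inf
      hc hc₀ hunit
  rw [kolyvaginClass_one_ne_zero_iff_not_exists_zsmul_eq W p K Dt β ι hp5 hs hK hlt hH d y hyd]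
  rintro ⟨Q, hQ⟩
  have h1 := one_le_padicLogOrd_of_zsmul_eq W p hp5 hadd ιp hQ hyinf
  omega

end NoGZ

/-! ## §4 Parts 1 + 2: the conductor-one transfer from lossless localisation of the lender's Heegner point -/

section Transfer

variable (W : WeierstrassCurve ℚ) [W.IsElliptic] [W.IsGloballyMinimal] [NeZero (W.conductorNorm ℤ)]
  (p : ℕ) [hp : Fact p.Prime] (K : Type) [Field K] [NumberField K]
  (Dt : ModularParametrizationData W (W.conductorNorm ℤ)) (β : ℤ) (ι : K →+* ℂ)

/-- **THE CONDUCTOR-ONE TRANSFER FROM LOSSLESS LOCALISATION** (sub-row (γ) of stub (A2) `stub_bottomTransfer`; parts 1 + 2, GZ-free).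
Frame: `E = W` globally minimal, ADDITIVE at `p ≥ 5`, `ρ̄_{E,p}` onto, `K` imaginary quadratic, `d_K < −4`, Heegner hypothesis for `N_E`,
`p ∤ c(Dt)`; avatar `E₀ = W₀` with a `Γ_ℚ`-equivariant `E[p] ≃ E₀[p]`, GOOD NON-ANOMALOUS at `p`, Heegner hypothesis for `N₀`, `p` split,
`p ∤ c(Dt₀)`, `hdep`; `hKL` BY NAME; LENDER INPUT: some Heegner point `y₀ ∈ E₀(K)` over `heegnerPointComplex Dt₀ H₀` is NOT `p`-divisible in
`E₀(ℚ_p)` along `ιp`. CONCLUSION: `c_E(1) = d.kolyvaginClass _ 1 ≠ 0` for every conductor-one datum `d`. [cite: KrizLi2019, Thm. 1.16]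
[cite: GrossLMS1991, §4 (4.4)] [cite: McCallumLMS1991, Cor. 4.5] -/
theorem kolyvaginClass_one_ne_zero_of_thm116_of_lossless (hKL : KrizLi2019.thm116_padicLogHeegner_congruence)
    (hp5 : 5 ≤ p) (hadd : Addv W p) (hs : W.HasSurjectiveModNGaloisRep p)
    (hK : IsImaginaryQuadratic K) (hlt : NumberField.discr K < -4)
    (hH : SatisfiesHeegnerHypothesis (W.conductorNorm ℤ) K) (hc : ¬ (p : ℤ) ∣ Dt.c)
    (W₀ : WeierstrassCurve ℚ) [W₀.IsElliptic] [W₀.IsGloballyMinimal] [NeZero (W₀.conductorNorm ℤ)]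
    (e : geomTorsion W (p : ℤ) ≃+ geomTorsion W₀ (p : ℤ))
    (he : ∀ (σ : absoluteGaloisGroup ℚ) (T : geomTorsion W (p : ℤ)), e (σ • T) = σ • e T)
    (hgood₀ : W₀.HasGoodReductionAtPrime p) (hna : ¬ (p : ℤ) ∣ W₀.frobeniusTrace p - 1)
    (hdep : ∀ ℓ ∈ KrizLi2019.depletionPrimes p W₀ W, ℓ ≠ p → ¬ (p : ℤ) ∣ KrizLi2019.nsPointCount W₀ ℓ)
    (Dt₀ : ModularParametrizationData W₀ (W₀.conductorNorm ℤ)) (hc₀ : ¬ (p : ℤ) ∣ Dt₀.c)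
    (hH₀ : SatisfiesHeegnerHypothesis (W₀.conductorNorm ℤ) K)
    (hsplit : ((Ideal.span {(p : ℤ)}).primesOver (𝓞 K)).ncard = 2) (ιp : K →+* ℚ_[p])
    (hloss : ∃ (H₀ : HeegnerDatum (W₀.conductorNorm ℤ) (NumberField.discr K)) (y₀ : (W₀.baseChange K).toAffine.Point),
      WeierstrassCurve.Affine.Point.map ι.toRatAlgHom y₀ = heegnerPointComplex Dt₀ H₀ ∧
        ¬ ∃ Q : (W₀.baseChange ℚ_[p]).toAffine.Point, (p : ℤ) • Q = X11b.padicPointOf W₀ p ιp y₀)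
    (d : KolyvaginHeegnerData Dt β ι 1) :
    d.kolyvaginClass hp.out 1 ≠ 0 := by
  obtain ⟨H₀, y₀, hy₀, hny₀⟩ := hloss
  have hc₀' : Dt₀.c ≠ 0 := by
    rintro h0
    exact hc₀ (by rw [h0]; exact dvd_zero _)
  exact kolyvaginClass_one_ne_zero_of_thm116' W p K Dt β ι hKL hp5 hadd hs hK hlt hH hc W₀ e he Dt₀ hc₀' hH₀ hsplit ιp
    (lenderLogUnit_of_not_exists_zsmul_eq W₀ p W (by omega) hgood₀ hna hdep Dt₀ hc₀ ι ιp H₀ y₀ hy₀ hny₀) d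

/-- **The same in the conclusion shape of `stub_bottomTransfer`** (`∃ m d, …`, `m = ∅`), given `4N_E ∣ β² − d_K`.
[cite: KrizLi2019, Thm. 1.16] [cite: GrossLMS1991, §4 (4.4)] [cite: Darmon2004, Thm. 3.6] -/
theorem exists_kolyvaginClass_ne_zero_of_thm116_of_lossless (hKL : KrizLi2019.thm116_padicLogHeegner_congruence)
    (hp5 : 5 ≤ p) (hadd : Addv W p) (hs : W.HasSurjectiveModNGaloisRep p)
    (hK : IsImaginaryQuadratic K) (hlt : NumberField.discr K < -4)
    (hH : SatisfiesHeegnerHypothesis (W.conductorNorm ℤ) K)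
    (hβ : (4 * (W.conductorNorm ℤ : ℤ)) ∣ β ^ 2 - NumberField.discr K) (hc : ¬ (p : ℤ) ∣ Dt.c)
    (W₀ : WeierstrassCurve ℚ) [W₀.IsElliptic] [W₀.IsGloballyMinimal] [NeZero (W₀.conductorNorm ℤ)]
    (e : geomTorsion W (p : ℤ) ≃+ geomTorsion W₀ (p : ℤ))
    (he : ∀ (σ : absoluteGaloisGroup ℚ) (T : geomTorsion W (p : ℤ)), e (σ • T) = σ • e T)
    (hgood₀ : W₀.HasGoodReductionAtPrime p) (hna : ¬ (p : ℤ) ∣ W₀.frobeniusTrace p - 1)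
    (hdep : ∀ ℓ ∈ KrizLi2019.depletionPrimes p W₀ W, ℓ ≠ p → ¬ (p : ℤ) ∣ KrizLi2019.nsPointCount W₀ ℓ)
    (Dt₀ : ModularParametrizationData W₀ (W₀.conductorNorm ℤ)) (hc₀ : ¬ (p : ℤ) ∣ Dt₀.c)
    (hH₀ : SatisfiesHeegnerHypothesis (W₀.conductorNorm ℤ) K)
    (hsplit : ((Ideal.span {(p : ℤ)}).primesOver (𝓞 K)).ncard = 2) (ιp : K →+* ℚ_[p])
    (hloss : ∃ (H₀ : HeegnerDatum (W₀.conductorNorm ℤ) (NumberField.discr K)) (y₀ : (W₀.baseChange K).toAffine.Point),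
      WeierstrassCurve.Affine.Point.map ι.toRatAlgHom y₀ = heegnerPointComplex Dt₀ H₀ ∧
        ¬ ∃ Q : (W₀.baseChange ℚ_[p]).toAffine.Point, (p : ℤ) • Q = X11b.padicPointOf W₀ p ιp y₀) :
    ∃ (m : Finset {ℓ // Zhang2014.IsKolyvaginPrime (W.conductorNorm ℤ) W K p ℓ})
      (d : KolyvaginHeegnerData Dt β ι (∏ ℓ ∈ m, (ℓ : ℕ))), d.kolyvaginClass hp.out 1 ≠ 0 := by
  obtain ⟨d⟩ := nonempty_kolyvaginHeegnerData_one W K Dt β ι hK hβ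
  exact ⟨∅, d, kolyvaginClass_one_ne_zero_of_thm116_of_lossless W p K Dt β ι hKL hp5 hadd hs hK hlt hH hc
    W₀ e he hgood₀ hna hdep Dt₀ hc₀ hH₀ hsplit ιp hloss d⟩

end Transfer

end Summit.BirchSwinnertonDyer.BirchSwinnertonDyer.Theorems.AdditiveKoly

end
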